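import Mathlib
import Summits.CriticalPhenomena.CardyFormulaZ2.Theorems.CardyMagicRigidityNestingRigidityBigLoopsFirstMoment
import HarnessLib

/-!
# A-priori polynomial LOWER bound on the positively weighted tower moments, both lattices
# (helper [B-low] of line `positive-cone-weight-doubling`, crux `NestingRigidity`)

Crux `Summit.CriticalPhenomena.CardyFormulaZ2.Theses.CardyMagicRigidity.NestingRigidity`
(stmt-CriticalPhenomena-4835), line `positive-cone-weight-doubling`, registered helper
`towerMoment_lower_latticeEnsembles` toward the shared stub `stub_uvDecoupling` (the Hölder reduction
[C] `uvDecoupling_of_untilted_bounds` needs an a-priori bound `r ^ C ≤ E_δ[w ^ N_0(r,1)]` for every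
weight `w > 0`, all small `r` and then all small meshes `δ`).

The proof is a FIRST-MOMENT argument (no arm events): Jensen's inequality `E[w^N] ≥ w^{E[N]}` for the
convex function `x ↦ w^x` reduces the lower bound to an a-priori LOGARITHMIC UPPER bound on the mean
tower count `meanTower E δ r = E_δ[N_0(r,1)]`, which follows from the landed keystone K1
`integral_ncard_bigLoops_le` (p125372: `E_δ[#{u : trace ⊆ B(0,R), diam ≥ η}] ≤ C (R/η)²`) summed over
the `O(log(1/r))` dyadic shells of the annulus `r < |z| < 1`:

* §1 (deterministic) a loop of the tower `(r; B(0,1))` whose outermost dyadic window is `B(0, 2^{-k})`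
  has a trace point of modulus `≥ 2^{-k-1}` and surrounds the origin, hence has diameter `≥ 2^{-k-1}`
  (`UnbasedLoop.setOf_wind_ne_zero_subset_closedBall`): the tower is covered by the `K + 1` families of
  BIG loops of the windows `B(0, 2^{-k})`, `k ≤ K`, as soon as `2^{-K-1} ≤ r`
  (`tower_subset_iUnion_shells`);
* §2 `meanTower_le_log_latticeEnsembles` (both lattices): `E_δ[N_0(r,1)] ≤ C log(1/r)` for
  `0 < δ`, `c₀ δ ≤ r ≤ 1/2` — the a-priori half of `NestingDensity`;
* §3 Jensen in tangent-line form (`rpow_meanTower_le_towerMoment`: `w ^ E_δ[N] ≤ E_δ[w ^ N]` for every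
  `w > 0`, every mesh) and the registered statement `towerMoment_lower_latticeEnsembles`
  (`C = 0` for `w ≥ 1`; `C = C₁ log(1/w)` for `w < 1`, `r₀ = 1/2`).
-/

noncomputable section

open MeasureTheory Set Filter Metric
open scoped Real Topology BigOperators

namespace Summit.CriticalPhenomena.CardyFormulaZ2.Cruxes.NestingRigidity.PositiveConeWeightDoubling

open Literature.Probability.RandomPlanarGeometry Literature.Probability.Percolation
  Literature.Probability.LatticeModels
open Summit.CriticalPhenomena.CardyFormulaZ2.Cruxes.NestingRigidity.RingCloudTomography

namespace TowerMomentLower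

/-! ## §1 Deterministic: the tower is covered by the big loops of `O(log(1/r))` dyadic windows -/

/-- A loop whose winding interior contains `B̄(0, r)` is not drawn inside `B(0, ρ)` for `ρ ≤ r`
(the point `r ∈ B̄(0, r)` would have winding number `0`). -/
theorem not_range_subset_ball_of_tower {u : UnbasedLoop ℂ} {r ρ : ℝ} (hr : 0 ≤ r)
    (hwind : closedBall (0 : ℂ) r ⊆ {z | u.wind z ≠ 0}) (hρ : ρ ≤ r) :
    ¬ u.range ⊆ ball (0 : ℂ) ρ := by
  intro h
  have hz : ((r : ℝ) : ℂ) ∈ closedBall (0 : ℂ) r := by simp [abs_of_nonneg hr]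
  exact hwind hz (u.wind_eq_zero_of_subset_ball h (by simp [abs_of_nonneg hr, hρ]))

/-- A loop surrounding the origin has diameter at least the modulus of each of its trace points
(its winding interior lies within `diam (trace)` of every trace point). -/
theorem norm_le_diam_of_tower {u : UnbasedLoop ℂ} {r : ℝ} (hr : 0 ≤ r)
    (hwind : closedBall (0 : ℂ) r ⊆ {z | u.wind z ≠ 0}) {z₀ : ℂ} (hz₀ : z₀ ∈ u.range) :
    ‖z₀‖ ≤ diam u.range := by
  have h0 : (0 : ℂ) ∈ {z | u.wind z ≠ 0} := hwind (mem_closedBall_self hr)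
  have h := u.setOf_wind_ne_zero_subset_closedBall hz₀ h0
  rwa [mem_closedBall, dist_comm, dist_zero_right] at h

/-- **Dyadic covering of the tower.**  If `2^{-(K+1)} ≤ r`, every loop surrounding `B̄(0, r)` with
trace in `B(0, 1)` is, for some `k ≤ K`, a loop with trace in `B(0, 2^{-k})` and diameter
`≥ 2^{-(k+1)}` (take the smallest dyadic window containing the trace). -/
theorem tower_subset_iUnion_shells (c : LoopConfig ℂ) {r : ℝ} (hr : 0 < r) {K : ℕ}
    (hK : (1 / 2 : ℝ) ^ (K + 1) ≤ r) :
    {u ∈ c.loops | closedBall (0 : ℂ) r ⊆ {z | u.wind z ≠ 0} ∧ u.range ⊆ ball (0 : ℂ) 1} ⊆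
      ⋃ k ∈ Finset.range (K + 1), {u ∈ c.loops | u.range ⊆ ball (0 : ℂ) ((1 / 2 : ℝ) ^ k) ∧
        (1 / 2 : ℝ) ^ (k + 1) ≤ diam u.range} := by
  classical
  rintro u ⟨hu, hwind, hrange⟩
  have hex : ∃ k : ℕ, ¬ u.range ⊆ ball (0 : ℂ) ((1 / 2 : ℝ) ^ k) :=
    ⟨K + 1, not_range_subset_ball_of_tower hr.le hwind hK⟩
  have hspec : ¬ u.range ⊆ ball (0 : ℂ) ((1 / 2 : ℝ) ^ Nat.find hex) := Nat.find_spec hex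
  have hle : Nat.find hex ≤ K + 1 := Nat.find_min' hex (not_range_subset_ball_of_tower hr.le hwind hK)
  have hne : Nat.find hex ≠ 0 := by
    intro h
    rw [h, pow_zero] at hspec
    exact hspec hrange
  obtain ⟨k, hk⟩ := Nat.exists_eq_add_one_of_ne_zero hne
  have hin : u.range ⊆ ball (0 : ℂ) ((1 / 2 : ℝ) ^ k) := by
    have h := Nat.find_min hex (show k < Nat.find hex by omega)
    rwa [not_not] at h
  have hout : ¬ u.range ⊆ ball (0 : ℂ) ((1 / 2 : ℝ) ^ (k + 1)) := by
    rw [hk] at hspec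
    exact hspec
  obtain ⟨z₀, hz₀, hz₀'⟩ := Set.not_subset.1 hout
  rw [mem_ball_zero_iff, not_lt] at hz₀'
  refine Set.mem_iUnion₂.2 ⟨k, Finset.mem_range.2 (by omega), hu, hin, ?_⟩
  exact hz₀'.trans (norm_le_diam_of_tower hr.le hwind hz₀)

/-! ## §2 The a-priori logarithmic bound on the mean tower count, both lattices -/

/-- **Mean tower count at dyadic depth `K`.**  For `E ∈ latticeEnsembles` there are `C, c₀ > 0` with
`E_δ[N_0(r, 1)] ≤ C (K + 1)` whenever `0 < δ`, `c₀ δ ≤ 2^{-(K+1)} ≤ r`: the dyadic covering and K1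
(`integral_ncard_bigLoops_le`, each shell costs `≤ 4 C_{K1}`). -/
theorem meanTower_le_depth : ∀ E ∈ latticeEnsembles, ∃ C c₀ : ℝ, 0 < C ∧ 0 < c₀ ∧
    ∀ (K : ℕ) (r δ : ℝ), 0 < δ → c₀ * δ ≤ (1 / 2 : ℝ) ^ (K + 1) → (1 / 2 : ℝ) ^ (K + 1) ≤ r →
      meanTower E δ r ≤ C * (K + 1) := by
  intro E hE
  obtain ⟨C, c₀, hC, hc₀, hK1⟩ := integral_ncard_bigLoops_le E hE
  refine ⟨4 * C, c₀, by positivity, hc₀, fun K r δ hδ hδK hKr ↦ ?_⟩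
  have hr : 0 < r := lt_of_lt_of_le (by positivity) hKr
  -- the dyadic shells and their first moments
  set S : ℕ → E.Ω → Set (UnbasedLoop ℂ) := fun k ω ↦ {u ∈ (E.X δ ω).loops |
    u.range ⊆ ball (0 : ℂ) ((1 / 2 : ℝ) ^ k) ∧ (1 / 2 : ℝ) ^ (k + 1) ≤ diam u.range}
  have hshell : ∀ k ∈ Finset.range (K + 1), Integrable (fun ω ↦ ((S k ω).ncard : ℝ)) E.P ∧
      ∫ ω, ((S k ω).ncard : ℝ) ∂E.P ≤ 4 * C := by
    intro k hk
    have hk' : k + 1 ≤ K + 1 := Nat.succ_le_succ (Nat.lt_succ_iff.1 (Finset.mem_range.1 hk))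
    have hη : c₀ * δ ≤ (1 / 2 : ℝ) ^ (k + 1) :=
      hδK.trans (pow_le_pow_of_le_one (by norm_num) (by norm_num) hk')
    have hηR : (1 / 2 : ℝ) ^ (k + 1) ≤ (1 / 2 : ℝ) ^ k :=
      pow_le_pow_of_le_one (by norm_num) (by norm_num) (Nat.le_succ k)
    obtain ⟨hint, hle⟩ := hK1 ((1 / 2 : ℝ) ^ k) ((1 / 2 : ℝ) ^ (k + 1)) δ hδ hη hηR
    refine ⟨hint, hle.trans ?_⟩
    have h2 : (1 / 2 : ℝ) ^ k / (1 / 2 : ℝ) ^ (k + 1) = 2 := by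
      rw [pow_succ, ← div_div, div_self (by positivity)]
      norm_num
    rw [h2]
    linarith
  -- the pointwise covering bound
  have hpt : ∀ ω, (towerCount (E.X δ ω) 0 r 1 : ℝ) ≤
      ∑ k ∈ Finset.range (K + 1), ((S k ω).ncard : ℝ) := by
    intro ω
    obtain ⟨N, hN⟩ := BigLoops.exists_ncard_loops_sep_le E hE hδ 1
    have hfin : {u ∈ (E.X δ ω).loops | u.range ⊆ ball (0 : ℂ) 1}.Finite :=
      (hN (fun u ↦ u.range ⊆ ball (0 : ℂ) 1) (fun _ h ↦ h) ω).1
    have hUfin : (⋃ k ∈ Finset.range (K + 1), S k ω).Finite :=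
      hfin.subset (Set.iUnion₂_subset fun k _ u hu ↦
        ⟨hu.1, hu.2.1.trans (ball_subset_ball (pow_le_one₀ (by norm_num) (by norm_num)))⟩)
    have h1 : towerCount (E.X δ ω) 0 r 1 ≤ ∑ k ∈ Finset.range (K + 1), (S k ω).ncard :=
      (Set.ncard_le_ncard (tower_subset_iUnion_shells (E.X δ ω) hr hKr) hUfin).trans
        (Finset.set_ncard_biUnion_le _ _)
    exact_mod_cast h1
  -- integrate
  calc meanTower E δ r = ∫ ω, (towerCount (E.X δ ω) 0 r 1 : ℝ) ∂E.P := rfl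
    _ ≤ ∫ ω, ∑ k ∈ Finset.range (K + 1), ((S k ω).ncard : ℝ) ∂E.P :=
        integral_mono (FirstMoment.integrable_towerCount E hE hδ 0 r 1)
          (integrable_finsetSum _ fun k hk ↦ (hshell k hk).1) hpt
    _ = ∑ k ∈ Finset.range (K + 1), ∫ ω, ((S k ω).ncard : ℝ) ∂E.P :=
        integral_finsetSum _ fun k hk ↦ (hshell k hk).1
    _ ≤ ∑ k ∈ Finset.range (K + 1), 4 * C := Finset.sum_le_sum fun k hk ↦ (hshell k hk).2
    _ = 4 * C * (K + 1) := by
        rw [Finset.sum_const, Finset.card_range, nsmul_eq_mul]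
        push_cast
        ring

end TowerMomentLower

/-- **A-priori logarithmic bound on the mean tower count, both lattices** (the a-priori half of
`NestingDensity`): for `E ∈ latticeEnsembles` there are `C, c₀ > 0` with
`meanTower E δ r = E_δ[N_0(r, 1)] ≤ C log(1/r)` whenever `0 < δ`, `c₀ δ ≤ r ≤ 1/2`. -/
theorem meanTower_le_log_latticeEnsembles : ∀ E ∈ latticeEnsembles, ∃ C c₀ : ℝ, 0 < C ∧ 0 < c₀ ∧
    ∀ (r δ : ℝ), 0 < δ → c₀ * δ ≤ r → r ≤ 1 / 2 → meanTower E δ r ≤ C * Real.log (1 / r) := by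
  intro E hE
  obtain ⟨C, c₀, hC, hc₀, h⟩ := TowerMomentLower.meanTower_le_depth E hE
  refine ⟨2 * C / Real.log 2, 2 * c₀, by positivity, by positivity, fun r δ hδ hδr hr2 ↦ ?_⟩
  have hr : 0 < r := lt_of_lt_of_le (by positivity) hδr
  have hlog2 : 0 < Real.log 2 := Real.log_pos one_lt_two
  -- the dyadic depth of `r`
  obtain ⟨n, hn, hn'⟩ := exists_nat_pow_near (x := 1 / r) (y := (2 : ℝ))
    (by rw [le_div_iff₀ hr]; linarith) one_lt_two
  have h2n : (0 : ℝ) < 2 ^ n := by positivity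
  have hhalf : (1 / 2 : ℝ) ^ n = 1 / 2 ^ n := by rw [one_div_pow]
  have hrn : r ≤ (1 / 2 : ℝ) ^ n := by
    rw [hhalf, le_div_iff₀ h2n]
    have := (le_div_iff₀ hr).1 hn
    linarith
  have hKr : (1 / 2 : ℝ) ^ (n + 1) ≤ r := by
    rw [one_div_pow, div_le_iff₀ (by positivity)]
    have := (div_le_iff₀ hr).1 hn'.le
    linarith
  have hδK : c₀ * δ ≤ (1 / 2 : ℝ) ^ (n + 1) := by
    rw [pow_succ]
    nlinarith
  have hmain := h n r δ hδ hδK hKr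
  -- `n + 1 ≤ 2 log(1/r) / log 2`
  have hnlog : (n : ℝ) * Real.log 2 ≤ Real.log (1 / r) := by
    rw [← Real.log_pow]
    exact Real.log_le_log h2n hn
  have h1log : Real.log 2 ≤ Real.log (1 / r) :=
    Real.log_le_log two_pos (by rw [le_div_iff₀ hr]; linarith)
  calc meanTower E δ r ≤ C * (n + 1) := hmain
    _ ≤ C * (2 * Real.log (1 / r) / Real.log 2) := by
        refine mul_le_mul_of_nonneg_left ?_ hC.le
        rw [le_div_iff₀ hlog2]
        nlinarith
    _ = 2 * C / Real.log 2 * Real.log (1 / r) := by ring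

/-! ## §3 Jensen and the registered lower bound -/

/-- **Jensen for the tower moment** (tangent line of `x ↦ w^x` at the mean): for every weight `w > 0`,
`w ^ E_δ[N_0(r,1)] ≤ E_δ[w ^ N_0(r,1)]` on both lattice ensembles, at every mesh `δ > 0`. -/
theorem rpow_meanTower_le_towerMoment : ∀ E ∈ latticeEnsembles, ∀ {w δ : ℝ}, 0 < w → 0 < δ →
    ∀ r : ℝ, w ^ meanTower E δ r ≤ E.towerMoment w δ r := by
  intro E hE w δ hw hδ r
  haveI := isProbabilityMeasure_of_mem hE
  set a := meanTower E δ r with ha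
  set b := Real.log w with hb
  have hN := FirstMoment.integrable_towerCount E hE hδ 0 r 1
  -- tangent line: `w ^ n = e^{b n} ≥ e^{a b} (1 + b (n - a))`
  have hpt : ∀ ω, Real.exp (a * b) + Real.exp (a * b) * b * ((towerCount (E.X δ ω) 0 r 1 : ℝ) - a) ≤
      w ^ towerCount (E.X δ ω) 0 r 1 := by
    intro ω
    set n : ℝ := (towerCount (E.X δ ω) 0 r 1 : ℝ)
    have hwn : w ^ towerCount (E.X δ ω) 0 r 1 = Real.exp (a * b) * Real.exp (b * (n - a)) := by
      rw [← Real.rpow_natCast, Real.rpow_def_of_pos hw, ← Real.exp_add]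
      congr 1
      ring
    rw [hwn]
    have h1 : b * (n - a) + 1 ≤ Real.exp (b * (n - a)) := Real.add_one_le_exp _
    nlinarith [Real.exp_pos (a * b)]
  have hsub : Integrable (fun ω ↦ (towerCount (E.X δ ω) 0 r 1 : ℝ) - a) E.P :=
    hN.sub (integrable_const a)
  have hmul : Integrable (fun ω ↦ Real.exp (a * b) * b * ((towerCount (E.X δ ω) 0 r 1 : ℝ) - a)) E.P :=
    hsub.const_mul _
  have hlin : Integrable (fun ω ↦ Real.exp (a * b) +
      Real.exp (a * b) * b * ((towerCount (E.X δ ω) 0 r 1 : ℝ) - a)) E.P :=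
    (integrable_const _).add hmul
  have hI : ∫ ω, Real.exp (a * b) + Real.exp (a * b) * b * ((towerCount (E.X δ ω) 0 r 1 : ℝ) - a) ∂E.P =
      Real.exp (a * b) := by
    rw [integral_add (integrable_const _) hmul, integral_const_mul, integral_sub hN (integrable_const a),
      integral_const, integral_const, show ∫ ω, (towerCount (E.X δ ω) 0 r 1 : ℝ) ∂E.P = a from rfl]
    simp
  calc w ^ a = Real.exp (a * b) := by rw [Real.rpow_def_of_pos hw, hb, mul_comm]
    _ = ∫ ω, Real.exp (a * b) + Real.exp (a * b) * b * ((towerCount (E.X δ ω) 0 r 1 : ℝ) - a) ∂E.P :=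
        hI.symm
    _ ≤ E.towerMoment w δ r :=
        integral_mono hlin (ConeTilt.integrable_pow_towerCount_of_nonneg E hE w hδ 0 r 1 hw.le) hpt

/-- **[B-low] A-priori polynomial LOWER bound on the positively weighted tower moments, both
lattices** (registered helper toward `stub_uvDecoupling`): for `E ∈ latticeEnsembles` and `w > 0`
there are `C` and `r₀ > 0` with `r ^ C ≤ E_δ[w ^ N_0(r,1)]` for all `r ∈ (0, r₀)` and all small meshes.
Jensen (`rpow_meanTower_le_towerMoment`) and the logarithmic mean bound
(`meanTower_le_log_latticeEnsembles`): `C = 0` for `w ≥ 1`, `C = C₁ log(1/w)` for `w < 1`. -/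
theorem towerMoment_lower_latticeEnsembles : ∀ E ∈ latticeEnsembles, ∀ w : ℝ, 0 < w →
    ∃ C r₀ : ℝ, 0 < r₀ ∧ ∀ r ∈ Set.Ioo (0 : ℝ) r₀, ∀ᶠ δ in 𝓝[>] (0 : ℝ), r ^ C ≤ E.towerMoment w δ r := by
  intro E hE w hw
  haveI := isProbabilityMeasure_of_mem hE
  obtain ⟨C₁, c₀, hC₁, hc₀, hmean⟩ := meanTower_le_log_latticeEnsembles E hE
  rcases le_or_gt 1 w with hw1 | hw1
  · -- `w ≥ 1`: `r ^ 0 = 1 ≤ w ^ E[N] ≤ E[w ^ N]`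
    refine ⟨0, 1, one_pos, fun r _ ↦ ?_⟩
    filter_upwards [self_mem_nhdsWithin] with δ hδ
    rw [Real.rpow_zero]
    refine le_trans (Real.one_le_rpow hw1 ?_) (rpow_meanTower_le_towerMoment E hE hw hδ r)
    exact integral_nonneg fun ω ↦ Nat.cast_nonneg _
  · -- `w < 1`: `r ^ (C₁ log(1/w)) = w ^ (C₁ log(1/r)) ≤ w ^ E[N] ≤ E[w ^ N]`
    refine ⟨C₁ * Real.log (1 / w), 1 / 2, by norm_num, fun r hr ↦ ?_⟩
    have hr0 : 0 < r := hr.1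
    filter_upwards [Ioo_mem_nhdsGT (show (0 : ℝ) < r / c₀ by positivity)] with δ hδ
    have hδr : c₀ * δ ≤ r := by
      have := (lt_div_iff₀ hc₀).1 hδ.2
      linarith
    have hm := hmean r δ hδ.1 hδr hr.2.le
    calc r ^ (C₁ * Real.log (1 / w)) = w ^ (C₁ * Real.log (1 / r)) := by
          rw [Real.rpow_def_of_pos hr0, Real.rpow_def_of_pos hw, one_div, one_div, Real.log_inv,
            Real.log_inv]
          congr 1
          ring
      _ ≤ w ^ meanTower E δ r := Real.rpow_le_rpow_of_exponent_ge hw hw1.le hm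
      _ ≤ E.towerMoment w δ r := rpow_meanTower_le_towerMoment E hE hw hδ.1 r

end Summit.CriticalPhenomena.CardyFormulaZ2.Cruxes.NestingRigidity.PositiveConeWeightDoubling

end
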